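import Summits.BirchSwinnertonDyer.BirchSwinnertonDyer.Theorems.ByReductionTypeAtTwoSupersingularFlatBlindLinePolys
import Summits.BirchSwinnertonDyer.BirchSwinnertonDyer.Theorems.ByReductionTypeAtTwoSupersingularFlatBlindLinePointReading
import Summits.BirchSwinnertonDyer.BirchSwinnertonDyer.Theorems.ByReductionTypeAtTwoSupersingularFlatColemanClauses
import Literature.Algebra.Module.PadicFunctionalSeparation
import HarnessLib

/-!
# Route `ByReductionTypeAtTwo` (rung K4), crux `SupersingularRankZeroAtTwo` (item stmt-BirchSwinnertonDyer-19097), line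
# `odd_blind_package`, slot 5 `stub_CD` = CDC_H, hand h9 = HT-C7locE = (hE), conjunct (C) (the LINE BOUND): **THE LINE POINT** —
# for every Honda-type system `c` at `p = 2` (levels + trace relations, even `a`) and every `k`, an explicit point
# `x = α(g⁻¹−1)·c_{2k+2} + β(g⁻¹−1)·c_{2k+1} ∈ E(K_{2k+2}·K_v)` which is (i) annihilated by `Ker Col♭` modulo `2^{k+2}`,
# (ii) anti-invariant modulo `2^{k+2}`: `g⁻¹x + x ∈ 2^{k+2}·E(K_∞·K_v)`, and (iii) as primitive as `c_0`: `z(x) ≡ z(c_0) (mod 2)`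
# for every functional `z` (cell `bsd-2adic`, seat `bsd-2adic-tower-1` GEN 62; any `K`, any completion)

HONEST FRAMING: THEOREMS ONLY (no definition, no named fact, no instance, no `sorry`); a helper `--supports 19097`; the point of this file is
the tower-side input of the line bound `2^J ≤ #L^E_J` (a class of order `2^J` in Sprung's ♭ condition twisted by `ψ₂`); nothing is booked;
BSD is proved for no curve by any of this. bears_on: K4 (19097).

## The construction

With the LINE POLYNOMIALS `(α, β)` of ★ `exists_linePolys` (p-LinePolys: `α u_n + β φ_n u_{n−1} = 2^{k+2}A'`,
`α v_n + β φ_n v_{n−1} = q + 2^{k+2}B'`, `(T+2)q = ω_n`, `q(−1) = −1`, `n = 2k+2`) put `x := α(σ−1)c_n + β(σ−1)c_{n−1}` (`σ = g⁻¹•`).  For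
every functional `z` with Coleman value `(L♯, L♭)`, ★ `omega_dvd_pairingSum_linePoint_add` (p-LinePointReading) gives
`ω_n ∣ P_{n,x}(z) + L♯·2^{k+2}A' + L♭·(q + 2^{k+2}B')`, and the READING LEMMA turns congruences of `P_{n,x}(z)` modulo `ω_n` into
congruences of `z(x)`:
* (i) `z ∈ Ker Col♭` (`L♭ = 0`): `P_{n,x}(z) ≡ 2^{k+2}(…)` ⟹ `2^{k+2} ∣ z(x)`;
* (ii) any `z`: `P_{n,g⁻¹x+x}(z) ≡ (T+2)P_{n,x}(z) ≡ −(T+2)(L♯·2^{k+2}A' + L♭ q + L♭ 2^{k+2}B') ≡ 2^{k+2}(…)` since `(T+2)q = ω_n`; so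
  `2^{k+2} ∣ z(g⁻¹x + x)` for EVERY `z`, whence `g⁻¹x + x ∈ 2^{k+2}E(K_∞·K_v)` by Pontryagin separation
  (`exists_nsmul_eq_of_forall_addMonoidHom_padicInt_dvd`, no `2`-torsion in the tower);
* (iii) any `z`: `L♭ q ≡ L♭(−2)·q (mod ω_n)` (Weierstrass remainder + `T + 2 ∣ r − r(−2)`), so `P_{n,x}(z) ≡ −L♭(−2)·q (mod ω_n, 2)` and
  `z(x) ≡ −L♭(−2)·q(−1) = L♭(−2) ≡ L♭(0) = −z(c_0) (mod 2)` (`constantCoeff_flat_eq_neg_apply`).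
★ `exists_linePoint` packages `x`, its level, and (i)–(iii).

References: [Sprung2012] F. Sprung, J. Number Theory 132 (2012), Def. 3.1, Def. 5.9, Def. 7.2, Def. 7.9 (pp. 1489–1503); [Kobayashi2003]
S. Kobayashi, Invent. math. 152 (2003), §8; [NeukirchSchmidtWingberg2008] I §1 (1.1.8) (Pontryagin duality); [Washington1997] Prop. 7.2.
-/

set_option autoImplicit false
set_option linter.dupNamespace false

noncomputable section

open scoped Classical

open Polynomial Finset

universe u

namespace Summit.BirchSwinnertonDyer.BirchSwinnertonDyer.Theorems

namespace OddBlindLocal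

open Literature.NumberTheory.EllipticCurves Literature.NumberTheory.GaloisRepresentations ZpExtension
  Literature.NumberTheory.EllipticCurves.Kobayashi2003 Literature.NumberTheory.EllipticCurves.Sprung2017
  Literature.NumberTheory.EllipticCurves.Sprung2012

section Generic

variable {K : Type u} [Field K] (κ : ZpExtension K 2)
variable {E : Type u} [Field E] [Algebra K E] (ι : AlgebraicClosure K →ₐ[K] AlgebraicClosure E)
variable (W : WeierstrassCurve K)

/-- `toIwasawa` of a constant. [folklore] -/
private theorem toIwasawa_C_two (c : ℤ) : toIwasawa 2 (C c) = PowerSeries.C (c : ℤ_[2]) := by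
  change ((((C c : ℤ[X]).map (Int.castRingHom ℤ_[2])) : ℤ_[2][X]) : PowerSeries ℤ_[2]) = _
  rw [Polynomial.map_C, Polynomial.coe_C, eq_intCast]

/-- The coercion `ℤ₂[T] → ℤ₂⟦T⟧` on the numeral `2`. [folklore] -/
private theorem coe_two_powerSeries : (((2 : ℤ_[2][X]) : ℤ_[2][X]) : PowerSeries ℤ_[2]) = 2 := by
  rw [← Polynomial.coeToPowerSeries.ringHom_apply, map_ofNat]

/-- `toIwasawa (T + 2) = T + 2`. [folklore] -/
private theorem toIwasawa_X_add_two : toIwasawa 2 (X + 2 : ℤ[X]) = PowerSeries.X + 2 := by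
  change ((((X + 2 : ℤ[X]).map (Int.castRingHom ℤ_[2])) : ℤ_[2][X]) : PowerSeries ℤ_[2]) = _
  rw [Polynomial.map_add, Polynomial.map_X, Polynomial.map_ofNat, Polynomial.coe_add, Polynomial.coe_X, coe_two_powerSeries]

/-- `toIwasawa` is the coercion of the mapped polynomial. [folklore] -/
private theorem toIwasawa_eq_coe_map (f : ℤ[X]) :
    toIwasawa 2 f = ((f.map (Int.castRingHom ℤ_[2]) : ℤ_[2][X]) : PowerSeries ℤ_[2]) := rfl

/-- ★ **THE LINE POINT.**  `κ` a `ℤ₂`-extension of `K`, `E` a completion, `g ∈ Γ_E` a lift of a topological generator, `c` a system of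
local points with `c n ∈ E(K_n·K_v)` and the trace relations `Tr_{n+1/n} c_{n+1} = a c_n − c_{n−1}` (`n ≥ 1`) for an EVEN `a`, and no
`2`-torsion in the tower `E(K_∞·K_v)`.  For every `k` there is a point `x ∈ E(K_{2k+2}·K_v)` with:
(i) `2^{k+2} ∣ z(x)` for every `z ∈ Ker Col♭`; (ii) `g⁻¹x + x = 2^{k+2} w` for a tower point `w`;
(iii) for every functional `z` with a Coleman value, `2 ∤ z(c_0) ⟹ 2 ∤ z(x)`.  See the module docstring.
[cite: Sprung2012, Def. 3.1 (p. 1489), Def. 5.9 (p. 1495), Def. 7.2 (p. 1500), Def. 7.9 (p. 1503)]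
[cite: NeukirchSchmidtWingberg2008, I §1 (1.1.8)] [cite: Washington1997, Prop. 7.2] -/
theorem exists_linePoint {a : ℤ} (ha : (2 : ℤ) ∣ a) {g : Field.absoluteGaloisGroup E}
    (hg : κ.IsTopGenerator (resGalOfEmb ι g)) {c : ℕ → localPoints W E} (hc : ∀ n, c n ∈ localLayerPointsOfEmb κ ι W n)
    (hTr : ∀ n, 1 ≤ n → localTraceOfEmb κ ι W n (n + 1) (c (n + 1)) = a • c n - c (n - 1))
    (hnt : ∀ P ∈ localTowerPointsOfEmb κ ι W, 2 • P = 0 → P = 0) (k : ℕ) :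
    ∃ (x : localPoints W E) (hx : x ∈ localLayerPointsOfEmb κ ι W (2 * k + 2)),
      (∀ z ∈ colemanKer κ ι W a g c .flat,
        (2 : ℤ_[2]) ^ (k + 2) ∣ z ⟨x, localLayerPointsOfEmb_le_localTowerPointsOfEmb κ ι W _ hx⟩) ∧
      (∃ w ∈ localTowerPointsOfEmb κ ι W, 2 ^ (k + 2) • w = g⁻¹ • x + x) ∧
      (∀ (z : localTowerPointsOfEmb κ ι W →+ ℤ_[2]) (Ls Lf : IwasawaAlgebra 2), IsColemanPair κ ι W a g c z Ls Lf →
        ¬ (2 : ℤ_[2]) ∣ z ⟨c 0, localLayerPointsOfEmb_le_localTowerPointsOfEmb κ ι W 0 (hc 0)⟩ →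
        ¬ (2 : ℤ_[2]) ∣ z ⟨x, localLayerPointsOfEmb_le_localTowerPointsOfEmb κ ι W _ hx⟩) := by
  have hle := fun n ↦ localLayerPointsOfEmb_le_localTowerPointsOfEmb κ ι W n
  have hstab : ∀ P ∈ localTowerPointsOfEmb κ ι W, g⁻¹ • P ∈ localTowerPointsOfEmb κ ι W :=
    fun P hP ↦ smul_mem_localTowerPointsOfEmb κ ι W g⁻¹ hP
  have ha' : ((2 : ℕ) : ℤ) ∣ a := by exact_mod_cast ha
  -- the line polynomials
  obtain ⟨α, β, q, A', B', hXq, hq1, hqdeg, hA, hB⟩ := exists_linePolys ha k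
  -- the point
  let σ : Module.End ℤ (localPoints W E) := (DistribSMul.toAddMonoidHom (localPoints W E) g⁻¹).toIntLinearMap
  have hσ : ∀ P, σ P = g⁻¹ • P := fun _ ↦ rfl
  set x : localPoints W E := aeval (σ - 1) α (c (2 * k + 2)) + aeval (σ - 1) β (c (2 * k + 1)) with hxdef
  have hlay : ∀ (m : ℕ) (r : ℤ[X]) {P : localPoints W E}, P ∈ localLayerPointsOfEmb κ ι W m →
      aeval (σ - 1) r P ∈ localLayerPointsOfEmb κ ι W m := fun m r P hP ↦
    aeval_mem_of_forall_smul_mem W hσ _ (fun Q hQ ↦ smul_mem_localLayerPointsOfEmb κ ι W m g⁻¹ hQ) r hP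
  have hx : x ∈ localLayerPointsOfEmb κ ι W (2 * k + 2) :=
    add_mem (hlay _ α (hc _)) (hlay _ β (localLayerPointsOfEmb_mono κ ι W (Nat.le_succ _) (hc (2 * k + 1))))
  have hxT : x ∈ localTowerPointsOfEmb κ ι W := hle _ hx
  refine ⟨x, hx, ?_, ?_, ?_⟩
  -- abbreviations in `Λ`
  · -- (i) `Ker Col♭` kills `x` modulo `2^{k+2}`
    intro z hz
    obtain ⟨Ls, Lf, hzC, hLf⟩ := hz
    rw [chromaticL_flat] at hLf
    subst hLf
    have hD := omega_dvd_pairingSum_linePoint_add κ ι W hg hc hσ (2 * k + 1) α β hzC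
    rw [show 2 * k + 1 + 1 = 2 * k + 2 by ring, hA, hB, map_mul, toIwasawa_C_two] at hD
    have hread := pow_dvd_apply_sub_eval_of_omega_dvd κ ι W g (n := 2 * k + 2) hxT z (F₀ := 0)
      (by rw [natDegree_zero]; positivity) (-(Ls * toIwasawa 2 A')) (k + 2) ?_
    · rwa [eval_zero, sub_zero] at hread
    · rw [← hxdef] at hD
      have e : pairingSum W (localTowerPointsOfEmb κ ι W) g (2 * k + 2) x z +
            (Ls * (PowerSeries.C ((2 ^ (k + 2) : ℤ) : ℤ_[2]) * toIwasawa 2 A') + 0 * toIwasawa 2 (q + C (2 ^ (k + 2)) * B')) =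
          pairingSum W (localTowerPointsOfEmb κ ι W) g (2 * k + 2) x z -
            (((0 : ℤ_[2][X]) : PowerSeries ℤ_[2]) + PowerSeries.C (((2 : ℕ) : ℤ_[2]) ^ (k + 2)) * -(Ls * toIwasawa 2 A')) := by
        rw [Polynomial.coe_zero]; push_cast; ring
      rw [← e]; exact hD
  · -- (ii) `g⁻¹ x + x ∈ 2^{k+2} E(K_∞·K_v)`: every functional is divisible by `2^{k+2}` there
    have hgx : g⁻¹ • x + x ∈ localTowerPointsOfEmb κ ι W := add_mem (hstab _ hxT) hxT
    have hdiv : ∀ z : localTowerPointsOfEmb κ ι W →+ ℤ_[2], (2 : ℤ_[2]) ^ (k + 2) ∣ z ⟨g⁻¹ • x + x, hgx⟩ := by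
      intro z
      obtain ⟨Ls, Lf, hzC⟩ := SSFlatEC.exists_isColemanPair_of_trace κ ι W hg ha' hc hTr z
      have hD := omega_dvd_pairingSum_linePoint_add κ ι W hg hc hσ (2 * k + 1) α β hzC
      rw [show 2 * k + 1 + 1 = 2 * k + 2 by ring, hA, hB, ← hxdef] at hD
      obtain ⟨Kx, hKx⟩ := hD
      -- `P_{n,g⁻¹x+x}(z) = (2+T)·P_{n,x}(z) − z(g⁻¹x)·ω_n`
      have hP2 : pairingSum W (localTowerPointsOfEmb κ ι W) g (2 * k + 2) (g⁻¹ • x + x) z =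
          (1 + PowerSeries.X) * pairingSum W (localTowerPointsOfEmb κ ι W) g (2 * k + 2) x z -
            PowerSeries.C (z ⟨g⁻¹ • x, hstab _ hxT⟩) * toIwasawa 2 (cyclotomicOmega 2 (2 * k + 2)) +
            pairingSum W (localTowerPointsOfEmb κ ι W) g (2 * k + 2) x z := by
        rw [← coe_thetaPoly, thetaPoly_add κ ι W g _ (hstab _ hxT) hxT, Polynomial.coe_add, coe_thetaPoly, coe_thetaPoly,
          pairingSum_inv_smul κ ι W hg hx z]
      -- `(T+2)·q = ω_n` in `Λ`
      have htq : (PowerSeries.X + 2) * toIwasawa 2 q = toIwasawa 2 (cyclotomicOmega 2 (2 * k + 2)) := by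
        rw [← toIwasawa_X_add_two, ← map_mul, hXq]
      refine (pow_dvd_apply_sub_eval_of_omega_dvd κ ι W g (n := 2 * k + 2) hgx z (F₀ := 0) (by rw [natDegree_zero]; positivity)
        (-((PowerSeries.X + 2) * (Ls * toIwasawa 2 A' + Lf * toIwasawa 2 B'))) (k + 2) ?_).trans (by rw [eval_zero, sub_zero])
      refine ⟨(PowerSeries.X + 2) * Kx - Lf - PowerSeries.C (z ⟨g⁻¹ • x, hstab _ hxT⟩), ?_⟩
      have hPx : pairingSum W (localTowerPointsOfEmb κ ι W) g (2 * k + 2) x z =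
          toIwasawa 2 (cyclotomicOmega 2 (2 * k + 2)) * Kx -
            (Ls * toIwasawa 2 (C (2 ^ (k + 2)) * A') + Lf * toIwasawa 2 (q + C (2 ^ (k + 2)) * B')) :=
        eq_sub_of_add_eq hKx
      rw [hP2, hPx, Polynomial.coe_zero, map_mul, map_add, map_mul, toIwasawa_C_two, ← htq]
      push_cast
      ring
    have hN : ∀ y : localTowerPointsOfEmb κ ι W, 2 • y = 0 → y = 0 := fun y hy ↦
      Subtype.ext (hnt _ y.2 (by rw [← AddSubgroupClass.coe_nsmul, hy]; rfl))
    obtain ⟨w, hw⟩ := Literature.Algebra.Module.exists_nsmul_eq_of_forall_addMonoidHom_padicInt_dvd hN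
      (k := k + 2) (n := ⟨g⁻¹ • x + x, hgx⟩) (fun z ↦ by exact_mod_cast hdiv z)
    exact ⟨w, w.2, by rw [← AddSubgroupClass.coe_nsmul, hw]⟩
  · -- (iii) `z(x) ≡ z(c_0) (mod 2)`
    intro z Ls Lf hzC hodd
    have hD := omega_dvd_pairingSum_linePoint_add κ ι W hg hc hσ (2 * k + 1) α β hzC
    rw [show 2 * k + 1 + 1 = 2 * k + 2 by ring, hA, hB, ← hxdef] at hD
    obtain ⟨Kx, hKx⟩ := hD
    -- Weierstrass remainder of `L♭` modulo `ω_n`, then modulo `T + 2`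
    obtain ⟨r, hr⟩ := exists_polynomial_toIwasawa_cyclotomicOmega_dvd_sub 2 (2 * k + 2) Lf
    obtain ⟨Kr, hKr⟩ := hr
    obtain ⟨r', hr'⟩ := X_sub_C_dvd_sub_C_eval (p := r) (a := (-2 : ℤ_[2]))
    rw [map_neg, sub_neg_eq_add, show (C 2 : ℤ_[2][X]) = 2 from rfl] at hr'
    set c₀ : ℤ_[2] := r.eval (-2) with hc₀
    -- `c₀ ≡ L♭(0) = −z(c_0) (mod 2)`
    have hLf0 : PowerSeries.constantCoeff Lf = r.eval 0 := by
      have h1 : PowerSeries.constantCoeff (Lf - (r : PowerSeries ℤ_[2])) = 0 :=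
        constantCoeff_eq_zero_of_toIwasawa_cyclotomicOmega_dvd ⟨Kr, hKr⟩
      rw [map_sub, sub_eq_zero, Polynomial.constantCoeff_coe, coeff_zero_eq_eval_zero] at h1
      exact h1
    have hc₀odd : ¬ (2 : ℤ_[2]) ∣ c₀ := by
      intro h2
      apply hodd
      have e : z ⟨c 0, hle 0 (hc 0)⟩ = -(r.eval 0) := by
        rw [← hLf0, SSFlatEC.constantCoeff_flat_eq_neg_apply hzC (hle 0 (hc 0)), neg_neg]
      have hd : (0 : ℤ_[2]) - (-2) ∣ r.eval 0 - r.eval (-2) := sub_dvd_eval_sub 0 (-2) r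
      rw [sub_neg_eq_add, zero_add] at hd
      rw [e, dvd_neg]
      have := dvd_add hd h2
      rwa [sub_add_cancel] at this
    -- `(T+2)·q = ω_n`, `L♭·q ≡ c₀·q (mod ω_n)`
    have htq : (PowerSeries.X + 2) * toIwasawa 2 q = toIwasawa 2 (cyclotomicOmega 2 (2 * k + 2)) := by
      rw [← toIwasawa_X_add_two, ← map_mul, hXq]
    have hLfq : Lf * toIwasawa 2 q = PowerSeries.C c₀ * toIwasawa 2 q +
        toIwasawa 2 (cyclotomicOmega 2 (2 * k + 2)) * (Kr * toIwasawa 2 q + (r' : PowerSeries ℤ_[2])) := by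
      have e1 : Lf = (r : PowerSeries ℤ_[2]) + toIwasawa 2 (cyclotomicOmega 2 (2 * k + 2)) * Kr := by
        rw [← hKr]; ring
      have e2 : ((r : ℤ_[2][X]) : PowerSeries ℤ_[2]) = PowerSeries.C c₀ + (PowerSeries.X + 2) * (r' : PowerSeries ℤ_[2]) := by
        have := congrArg (fun f : ℤ_[2][X] ↦ (f : PowerSeries ℤ_[2])) hr'
        simp only [Polynomial.coe_sub, Polynomial.coe_C, Polynomial.coe_mul, Polynomial.coe_add, Polynomial.coe_X,
          coe_two_powerSeries] at this
        rw [hc₀]; linear_combination this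
      rw [e1, e2]
      linear_combination ((r' : ℤ_[2][X]) : PowerSeries ℤ_[2]) * htq
    -- read at `T = −1`
    have hF₀deg : (-(C c₀ * q.map (Int.castRingHom ℤ_[2]))).natDegree < 2 ^ (2 * k + 2) := by
      rw [natDegree_neg]
      exact lt_of_le_of_lt ((natDegree_C_mul_le _ _).trans (natDegree_map_le)) hqdeg
    have hread := pow_dvd_apply_sub_eval_of_omega_dvd κ ι W g (n := 2 * k + 2) hxT z hF₀deg
      (-(PowerSeries.C ((2 : ℤ_[2]) ^ (k + 1)) * (Ls * toIwasawa 2 A' + Lf * toIwasawa 2 B'))) 1 ?_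
    · have hev : (-(C c₀ * q.map (Int.castRingHom ℤ_[2]))).eval (-1) = c₀ := by
        rw [eval_neg, eval_mul, eval_C, show (-1 : ℤ_[2]) = ((-1 : ℤ) : ℤ_[2]) by norm_num, eval_intCast_map, Int.cast_id,
          hq1, map_neg, map_one]
        ring
      rw [pow_one, hev] at hread
      intro h2
      exact hc₀odd (by simpa using dvd_sub h2 hread)
    · refine ⟨Kx - (Kr * toIwasawa 2 q + (r' : PowerSeries ℤ_[2])), ?_⟩
      have hPx : pairingSum W (localTowerPointsOfEmb κ ι W) g (2 * k + 2) x z =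
          toIwasawa 2 (cyclotomicOmega 2 (2 * k + 2)) * Kx -
            (Ls * toIwasawa 2 (C (2 ^ (k + 2)) * A') + Lf * toIwasawa 2 (q + C (2 ^ (k + 2)) * B')) :=
        eq_sub_of_add_eq hKx
      rw [hPx, map_mul, map_add, map_mul, toIwasawa_C_two, mul_add Lf, hLfq, Polynomial.coe_neg, Polynomial.coe_mul,
        Polynomial.coe_C, ← toIwasawa_eq_coe_map]
      push_cast
      simp only [map_pow]
      ring

end Generic

end OddBlindLocal

end Summit.BirchSwinnertonDyer.BirchSwinnertonDyer.Theorems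

end
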